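import Summits.QuantumFields.BalabanUV.T4Continuum.Support.NE9MajorantLipschitzSharp

/-!
# NE9MajorantRoom — the DOUBLED majorant of the two-family pinned cluster-sum bound is ROOM: KP for `(1+η)·m` gives
# `touchDiffSum ≤ (ε∕η)·a(γ)` for every `η > 0` (η = 1 is the tree's theorem); plus the real-analysis engine of the companion
# NECESSITY file `NE9MajorantRoomNecessity` (under the UNDOUBLED clause, η = 0, no constant works — a polymer STAR)

Cell `pub-balaban`, T4-DAG §6 row NE9; NE9 crux team (coordinator ruling «YM REDIRECT» e34b3e0c (2)), leaf lineage
`b2b-balaban-t4-ne9-formalise-leaf-03` generation 49; part 1 of 2.  CONTEXT: `t4/ROUTES-NE9.md` v9 → v12.0.1 §L1.1 ∕ §V12 (1) carries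
the pricing question **P-R1′-AUG-2** OPEN («is there a KP(m) road to the coupling-Lipschitz letter (L) from `hCup` + the un-augmented
pencil WITHOUT a coupling-holomorphy letter?»; holder «any holder»), and leaf-06's `NE9MajorantLipschitzSharp` locates it («KP for `2m`
REMAINS the hypothesis of the coupling half — the SLACK of KP is what the Cauchy radius `1/ε` consumes; KP for `m` alone gives no radius;
(L) on KP(m) needs either coupling holomorphy with its own majorant or a different mechanism»).  The letter in question is the tree's
ENGINE inequality behind every coupling half of the row (`T4ActivityLipschitz.touchDiffSum_le_of_majorant`, leaf-06's `…_sharp`; =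
`T4HistoryLipschitzSegment.TwoPointKP`'s `2n` clause = the record ENDs' binder `hkp2`): two activity families `wA`, `wB` on a finite
volume `L`, dominated by ONE majorant `m` with `‖wA − wB‖ ≤ ε·m`, and the Kotecký–Preiss clause for the DOUBLED majorant `2m`
⊢ `Σ_{C ⊆ L, C ι γ} ‖Φ^T(C; wA) − Φ^T(C; wB)‖·e^{d(C)} ≤ ε·a(γ)` (`touchDiffSum`).  This pair of files answers: the doubling is ROOM,
any room `η > 0` works at rate `1∕η` (this file), and NO room (η = 0) admits NO constant — not even a modulus of continuity (the sequel).

WHAT THIS FILE PROVES (kernel; abstract polymer gases only).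
* §0 [folklore] `polymerPartitionFunction_eq_prod_one_add` (a pairwise compatible family has `Z = ∏ (1 + w)`, `Finset.prod_one_add`),
  `sum_truncatedWeight_touches_eq` (`Σ_{C ⊆ L, C ι γ} Φ^T(C; w) = log Z(L; w) − log Z(L off γ; w)`, Möbius bookkeeping on the tree's
  `polymerLogZ_eq_sum_truncatedWeight`), `norm_sub_le_touchDiffSum` (the pinned two-family sum dominates the difference of these
  log-ratios, `d ≥ 0`).
* §1 [folklore] **ROOM SUFFICES, AT RATE 1∕η**: `touchDiffSum_le_of_majorant_room` — the binders of `touchDiffSum_le_of_majorant_sharp` with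
  `2·m ↦ (1+η)·m`, `η > 0` ⊢ `touchDiffSum ≤ (ε∕η)·a(γ)` (the affine interpolation is a convex combination on the real segment, so the
  stadium of radius `η∕ε` about it stays below `(1+η)·m`; the owner's∕refuter's stadium lemma `NE9PencilEndSharp.touchDiffSum_le_of_kp_open_family`),
  and the cluster-sum face `norm_clusterSum_sub_le_of_majorant_room` (`≤ (ε∕η)·a(γ)·e^{−δ}`).  η = 1 is leaf-06's constant-1 theorem.
* §R (real analysis for the sequel's STAR) `third_le_exp_neg`, **`star_real_core`** — for `0 ≤ μ < 1`, `0 ≤ xc`,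
  `mc = xc·e^{−(xc+s)}`, `0 ≤ t₀ ≤ 1`, `K : ℕ` and POSITIVE `Z₁ = (1−μ)^K − mc`, `Z₀ = (1−t₀μ)^K − t₀·mc`:
  `(1 − t₀)(1 + Kμ)·xc·e^{−(xc+s) + t₀Kμ} ≤ (log Z₀ − log (1−t₀μ)^K) − (log Z₁ − log (1−μ)^K)` (Bernoulli `(1 − t₀μ)^K ≥ (1−μ)^K(1 + K(1−t₀)μ)`,
  `1 − y ≤ e^{−y}`, `1 − x⁻¹ ≤ log x`), and `star_scale` (the arithmetic of the scale `μ = 1∕(8n)`, `xc = 1∕(16n)`, `t₀ = 1 − 1∕(4n)`,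
  `K = 8n²`).  In the sequel these closed forms ARE the star's partition functions, and the right-hand side is `≤ touchDiffSum`.
HONEST FRAMING (T4-DAG PAGE 1).  Rung (B)+1 of the FINITE-VOLUME T⁴ programme — NOT infinite volume, NOT a mass gap, NOT the Clay
problem.  NE9 (`T4OutputRate.NE9` ∧ `FadingMemory`) is a cell NEW ESTIMATE, NOT PRINTED in [Balaban1987RG1] (CMP **109**) ∕
[Balaban1988RG2Cluster] (CMP **116**), NOT PROVED for Bałaban's E^{(j)}; the row is WALLED ON A MODEL (O-NE9-1); spine PROVED 0∕9.
A room∕tightness theorem about the ABSTRACT engine and a pricing answer INSIDE a conditional reduction are NOT progress on the estimate.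
HONEST DEPENDENCY (cell line, verbatim): continuum YM on T⁴ ⇐ BetaPertH ∧ nine spine estimates (0/9 proved); BetaPertH ⇐ (D1) ∧
(D4) ∧ CAP+tail; G-an2-4 gates asym, D1 and NE2/3/4.  `FlowStep.BetaPertH`, (B), (B^μ) do not occur.  Nothing of Bałaban's is typed,
instantiated or discharged; [KP86] is referred to for the TYPE of the clause only (ABSOLUTE RULE).  0 sorry, no `def`.  Summits-side NEW
work (LEAN PLACEMENT RULE); imports leaf-06's `NE9MajorantLipschitzSharp` BY NAME; modifies nothing; no END re-wired; no object of MODEL O-NE9-1.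
References (TYPES only): [KoteckyPreiss1986] R. Kotecký, D. Preiss, CMP **103** (1986) 491–498, Theorem p. 492 (1), (2), (4);
[Balaban1988RG2Cluster] T. Bałaban, CMP **116** (1988) 1–22, (2.13)–(2.15) pp. 14–15, Lemma 3 (2.38) p. 20, (2.40)–(2.41) p. 21.
-/

noncomputable section

namespace Summit.QuantumFields.BalabanUV.T4Continuum.NE9MajorantRoom

open scoped BigOperators
open Metric Set
open Literature.Probability.LatticeModels
open Literature.MathematicalPhysics.QuantumFieldTheory.Balaban1983to89.T4ActivityLipschitz
open Summit.QuantumFields.BalabanUV.T4Continuum.NE9PencilEndSharp (touchDiffSum_le_of_kp_open_family)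

/-! ## §0 Bookkeeping: touching families as a log-ratio; pairwise compatible families -/

section Generic

variable {P : Type*} [DecidableEq P] {inc : P → P → Prop} [DecidableRel inc]

/-- [folklore] A PAIRWISE COMPATIBLE finite family (distinct members never incompatible) has `Z(Λ; w) = ∏_{γ ∈ Λ} (1 + w γ)`: every
sub-family is compatible, and `∏ (1 + w) = Σ_{A ⊆ Λ} ∏_A w` (`Finset.prod_one_add`). -/
theorem polymerPartitionFunction_eq_prod_one_add (w : P → ℂ) {Λ : Finset P}
    (h : ∀ γ ∈ Λ, ∀ γ' ∈ Λ, γ ≠ γ' → ¬ inc γ γ') :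
    polymerPartitionFunction inc w Λ = ∏ γ ∈ Λ, (1 + w γ) := by
  rw [Finset.prod_one_add]
  unfold polymerPartitionFunction
  refine Finset.sum_congr rfl fun A hA => ?_
  have hAΛ : A ⊆ Λ := Finset.mem_powerset.1 hA
  have hc : IsCompatible inc A := fun x hx y hy hxy => h x (hAΛ hx) y (hAΛ hy) hxy
  rw [if_pos hc]

/-- [folklore] **The touching truncated weights sum to a log-ratio**: `Σ_{C ⊆ L, C ι γ} Φ^T(C; w) = log Z(L; w) − log Z(L off γ; w)`,
`L off γ = {γ′ ∈ L : ¬ γ′ ι γ}` — the families NOT touching `γ` are exactly the sub-families of `L off γ`, and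
`log Z = Σ_{C ⊆ ·} Φ^T` on both volumes ([KP86] (2), the tree's `polymerLogZ_eq_sum_truncatedWeight`). -/
theorem sum_truncatedWeight_touches_eq (w : P → ℂ) (L : Finset P) (γ : P) :
    ∑ C ∈ L.powerset with KPTouches inc C γ, truncatedWeight inc w C =
      polymerLogZ inc w L - polymerLogZ inc w (L.filter fun γ' => ¬ inc γ' γ) := by
  rw [polymerLogZ_eq_sum_truncatedWeight, polymerLogZ_eq_sum_truncatedWeight, eq_sub_iff_add_eq]
  have hset : (L.filter fun γ' => ¬ inc γ' γ).powerset = L.powerset.filter fun C => ¬ KPTouches inc C γ := by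
    ext C
    simp only [Finset.mem_powerset, Finset.mem_filter, Finset.subset_iff, KPTouches, not_exists, not_and]
    exact ⟨fun hC => ⟨fun x hx => (hC hx).1, fun x hx => (hC hx).2⟩, fun hC x hx => ⟨hC.1 hx, hC.2 x hx⟩⟩
  rw [hset, Finset.sum_filter_add_sum_filter_not]

/-- [folklore] **The pinned two-family sum dominates the difference of the touching log-ratios** (`d ≥ 0`):
`‖(log Z(L;wA) − log Z(L off γ;wA)) − (log Z(L;wB) − log Z(L off γ;wB))‖ ≤ touchDiffSum inc wA wB d L γ`. -/
theorem norm_sub_le_touchDiffSum (wA wB : P → ℂ) {d : P → ℝ} (hd : ∀ γ, 0 ≤ d γ) (L : Finset P) (γ : P) :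
    ‖(polymerLogZ inc wA L - polymerLogZ inc wA (L.filter fun γ' => ¬ inc γ' γ)) -
        (polymerLogZ inc wB L - polymerLogZ inc wB (L.filter fun γ' => ¬ inc γ' γ))‖ ≤
      touchDiffSum inc wA wB d L γ := by
  rw [← sum_truncatedWeight_touches_eq, ← sum_truncatedWeight_touches_eq, ← Finset.sum_sub_distrib]
  refine (norm_sum_le _ _).trans ?_
  unfold touchDiffSum
  refine Finset.sum_le_sum fun C _ => ?_
  have h1 : (1 : ℝ) ≤ Real.exp (∑ γ' ∈ C, d γ') := Real.one_le_exp (Finset.sum_nonneg fun γ' _ => hd γ')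
  nlinarith [norm_nonneg (truncatedWeight inc wA C - truncatedWeight inc wB C)]

end Generic

/-! ## §1 ROOM SUFFICES: KP for `(1+η)·m` gives the pinned two-family bound at rate `1∕η` -/

section Room

variable {P : Type*} [DecidableEq P] {inc : P → P → Prop} [DecidableRel inc]

/-- [folklore] **`touchDiffSum_le_of_majorant` WITH ROOM `η`.**  `inc` reflexive and symmetric, `a, d ≥ 0`, `0 ≤ ε`, `0 < η`; on `L`:
`‖wA‖, ‖wB‖ ≤ m`, `‖wA − wB‖ ≤ ε·m`, and the `d`-weighted KP clause for the majorant `(1+η)·m` with size `a`.  Then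
`touchDiffSum inc wA wB d L γ ≤ (ε∕η)·a(γ)` for `γ ∈ L`.  Proof: the affine interpolation `wB + z•(wA − wB)` is a convex combination on
the real segment (norm `≤ m`), so on the stadium of radius `η∕ε` about it the activities stay below `(1+η)·m`; the stadium lemma
gives `a(γ)∕(η∕ε)`.  η = 1 is `NE9MajorantLipschitzSharp.touchDiffSum_le_of_majorant_sharp`. -/
theorem touchDiffSum_le_of_majorant_room [Std.Refl inc] [Std.Symm inc] {wA wB : P → ℂ} {m a d : P → ℝ}
    (ha : ∀ γ, 0 ≤ a γ) (hd : ∀ γ, 0 ≤ d γ) {L : Finset P} {ε η : ℝ} (hε : 0 ≤ ε) (hη : 0 < η)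
    (hA : ∀ γ ∈ L, ‖wA γ‖ ≤ m γ) (hB : ∀ γ ∈ L, ‖wB γ‖ ≤ m γ)
    (hAB : ∀ γ ∈ L, ‖wA γ - wB γ‖ ≤ ε * m γ)
    (hKP : ∀ γ ∈ L, ∑ γ' ∈ L with inc γ' γ, (1 + η) * m γ' * Real.exp (a γ' + d γ') ≤ a γ)
    {γ : P} (hγ : γ ∈ L) :
    touchDiffSum inc wA wB d L γ ≤ ε / η * a γ := by
  set w : ℂ → P → ℂ := fun z γ' => wB γ' + z * (wA γ' - wB γ') with hw
  have hm0 : ∀ γ' ∈ L, 0 ≤ m γ' := fun γ' hγ' => (norm_nonneg _).trans (hA γ' hγ')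
  have key : ∀ R : ℝ, 0 < R → R * ε ≤ η → touchDiffSum inc wA wB d L γ ≤ a γ / R := by
    intro R hR hRε
    set U : Set ℂ := thickening R (segment ℝ (0 : ℂ) 1) with hU
    have hUo : IsOpen U := isOpen_thickening
    have hseg : ∀ x ∈ segment ℝ (0 : ℂ) 1, ball x R ⊆ U := fun x hx z hz =>
      mem_thickening_iff.2 ⟨x, hx, mem_ball.1 hz⟩
    have hwd : ∀ γ' ∈ L, DifferentiableOn ℂ (fun z => w z γ') U := fun γ' _ =>
      ((differentiable_const _).add (differentiable_id.mul (differentiable_const _))).differentiableOn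
    have hconv : ∀ x ∈ segment ℝ (0 : ℂ) 1, ∀ γ' ∈ L, ‖w x γ'‖ ≤ m γ' := by
      rintro x ⟨p, q, hp, hq, hpq, rfl⟩ γ' hγ'
      have hx : p • (0 : ℂ) + q • (1 : ℂ) = ((q : ℝ) : ℂ) := by simp
      have hsplit : w (p • (0 : ℂ) + q • (1 : ℂ)) γ' = ((p : ℝ) : ℂ) * wB γ' + ((q : ℝ) : ℂ) * wA γ' := by
        simp only [hw, hx]
        have hp' : ((p : ℝ) : ℂ) = 1 - ((q : ℝ) : ℂ) := by
          rw [← Complex.ofReal_one, ← Complex.ofReal_sub]; congr 1; linarith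
        rw [hp']; ring
      rw [hsplit]
      calc ‖((p : ℝ) : ℂ) * wB γ' + ((q : ℝ) : ℂ) * wA γ'‖ ≤ ‖((p : ℝ) : ℂ) * wB γ'‖ + ‖((q : ℝ) : ℂ) * wA γ'‖ :=
            norm_add_le _ _
        _ = p * ‖wB γ'‖ + q * ‖wA γ'‖ := by
            rw [norm_mul, norm_mul, Complex.norm_real, Complex.norm_real, Real.norm_of_nonneg hp,
              Real.norm_of_nonneg hq]
        _ ≤ p * m γ' + q * m γ' :=
            add_le_add (mul_le_mul_of_nonneg_left (hB γ' hγ') hp) (mul_le_mul_of_nonneg_left (hA γ' hγ') hq)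
        _ = m γ' := by rw [← add_mul, hpq, one_mul]
    have h2m : ∀ z ∈ U, ∀ γ' ∈ L, ‖w z γ'‖ ≤ (1 + η) * m γ' := by
      intro z hz γ' hγ'
      obtain ⟨x, hx, hzx⟩ := mem_thickening_iff.1 hz
      have hdiff : w z γ' = w x γ' + (z - x) * (wA γ' - wB γ') := by simp only [hw]; ring
      rw [hdiff]
      calc ‖w x γ' + (z - x) * (wA γ' - wB γ')‖ ≤ ‖w x γ'‖ + ‖(z - x) * (wA γ' - wB γ')‖ := norm_add_le _ _
        _ ≤ m γ' + R * (ε * m γ') := by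
            refine add_le_add (hconv x hx γ' hγ') ?_
            rw [norm_mul]
            exact mul_le_mul (by rw [← dist_eq_norm]; exact hzx.le) (hAB γ' hγ') (norm_nonneg _) hR.le
        _ ≤ (1 + η) * m γ' := by nlinarith [hm0 γ' hγ', mul_le_mul_of_nonneg_right hRε (hm0 γ' hγ')]
    have hKPU : ∀ z ∈ U, ∀ γ₀ ∈ L, ∑ γ' ∈ L with inc γ' γ₀, ‖w z γ'‖ * Real.exp (a γ' + d γ') ≤ a γ₀ := by
      intro z hz γ₀ hγ₀
      refine le_trans (Finset.sum_le_sum fun γ' hγ' => ?_) (hKP γ₀ hγ₀)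
      exact mul_le_mul_of_nonneg_right (h2m z hz γ' (Finset.mem_filter.1 hγ').1) (Real.exp_nonneg _)
    have h := touchDiffSum_le_of_kp_open_family (inc := inc) (w := w) ha hd hUo hR hseg hwd hKPU hγ
    have h1 : w 1 = wA := by funext γ'; simp [hw]
    have h0 : w 0 = wB := by funext γ'; simp [hw]
    rwa [h1, h0] at h
  rcases hε.eq_or_lt with h0 | hpos
  · -- `ε = 0`: every radius is admissible
    rw [← h0, zero_div, zero_mul]
    refine le_of_forall_pos_le_add fun θ hθ => ?_
    rw [zero_add]
    rcases (ha γ).eq_or_lt with ha0 | hapos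
    · have := key 1 one_pos (by rw [← h0, mul_zero]; exact hη.le)
      rw [← ha0, zero_div] at this
      exact this.trans hθ.le
    · have hR : 0 < a γ / θ := div_pos hapos hθ
      have := key (a γ / θ) hR (by rw [← h0, mul_zero]; exact hη.le)
      rwa [div_div_cancel₀ hapos.ne'] at this
  · have h1 := key (η / ε) (div_pos hη hpos) (by rw [div_mul_cancel₀ _ hpos.ne'])
    calc touchDiffSum inc wA wB d L γ ≤ a γ / (η / ε) := h1
      _ = ε / η * a γ := by rw [div_div_eq_mul_div]; ring

/-- [folklore] **The cluster-sum face with room**: the binders of `norm_clusterSum_sub_le_of_majorant_sharp` with `2·m ↦ (1+η)·m`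
⊢ `‖E_{wA}(𝒞) − E_{wB}(𝒞)‖ ≤ (ε∕η)·a(γ)·e^{−δ}`. -/
theorem norm_clusterSum_sub_le_of_majorant_room [Std.Refl inc] [Std.Symm inc] {wA wB : P → ℂ} {m a d : P → ℝ}
    (ha : ∀ γ, 0 ≤ a γ) (hd : ∀ γ, 0 ≤ d γ) {L : Finset P} {ε η : ℝ} (hε : 0 ≤ ε) (hη : 0 < η)
    (hA : ∀ γ ∈ L, ‖wA γ‖ ≤ m γ) (hB : ∀ γ ∈ L, ‖wB γ‖ ≤ m γ)
    (hAB : ∀ γ ∈ L, ‖wA γ - wB γ‖ ≤ ε * m γ)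
    (hKP : ∀ γ ∈ L, ∑ γ' ∈ L with inc γ' γ, (1 + η) * m γ' * Real.exp (a γ' + d γ') ≤ a γ)
    {𝒞 : Finset (Finset P)} {γ : P} (hγ : γ ∈ L) (hsub : ∀ C ∈ 𝒞, C ⊆ L)
    (hpin : ∀ C ∈ 𝒞, KPTouches inc C γ) {δ : ℝ} (hdec : ∀ C ∈ 𝒞, δ ≤ ∑ γ' ∈ C, d γ') :
    ‖clusterSum inc wA 𝒞 - clusterSum inc wB 𝒞‖ ≤ ε / η * a γ * Real.exp (-δ) := by
  have hloc := sum_norm_truncatedWeight_sub_le_touchDiffSum (inc := inc) (wA := wA) (wB := wB) d hsub hpin hdec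
  have key := touchDiffSum_le_of_majorant_room (inc := inc) ha hd hε hη hA hB hAB hKP hγ
  calc ‖clusterSum inc wA 𝒞 - clusterSum inc wB 𝒞‖
      ≤ ∑ C ∈ 𝒞, ‖truncatedWeight inc wA C - truncatedWeight inc wB C‖ := by
        unfold clusterSum
        rw [← Finset.sum_sub_distrib]
        exact norm_sum_le _ _
    _ ≤ touchDiffSum inc wA wB d L γ * Real.exp (-δ) := hloc
    _ ≤ ε / η * a γ * Real.exp (-δ) := mul_le_mul_of_nonneg_right key (Real.exp_nonneg _)

end Room

/-! ## §R Real analysis for the sequel's star: an elementary bound, the core log-ratio inequality, the scale arithmetic -/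

/-- Elementary: `1∕3 ≤ e^{−13∕16}` (`e^{13∕16} ≤ e < 3`). -/
theorem third_le_exp_neg : (1 : ℝ) / 3 ≤ Real.exp (-(13 / 16)) := by
  rw [Real.exp_neg, one_div, inv_le_inv₀ (by norm_num) (Real.exp_pos _)]
  calc Real.exp (13 / 16) ≤ Real.exp 1 := Real.exp_le_exp.2 (by norm_num)
    _ ≤ 3 := by linarith [Real.exp_one_lt_d9]

/-- **The real inequality behind the core bound.**  For `0 ≤ μ < 1`, `0 ≤ xc`, `mc = xc·e^{−(xc+s)}`, `0 ≤ t₀ ≤ 1`, `K : ℕ`, and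
POSITIVE `Z₁ = (1−μ)^K − mc`, `Z₀ = (1−t₀μ)^K − t₀·mc`:
`(1 − t₀)(1 + Kμ)·xc·e^{−(xc+s) + t₀Kμ} ≤ (log Z₀ − log q₀) − (log Z₁ − log q₁)`, `q_t = (1 − tμ)^K`.
Chain: LHS ≤ (1 − t₀)(1 + Kμ)·mc∕q₀ (`q₀ ≤ e^{−t₀Kμ}` from `1 − y ≤ e^{−y}`) ≤ mc∕q₁ − t₀·mc∕q₀ (Bernoulli:
`q₀ ≥ q₁·(1 + K(1−t₀)μ)`) = Z₀∕q₀ − Z₁∕q₁ ≤ (Z₀∕q₀ − Z₁∕q₁)∕(Z₀∕q₀) (`0 < Z₀∕q₀ ≤ 1`) = 1 − ((Z₀∕q₀)∕(Z₁∕q₁))⁻¹ ≤ log((Z₀∕q₀)∕(Z₁∕q₁)). -/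
theorem star_real_core {μ xc s mc t₀ : ℝ} (K : ℕ) (hμ0 : 0 ≤ μ) (hμ1 : μ < 1) (hxc : 0 ≤ xc)
    (hmc : mc = xc * Real.exp (-(xc + s))) (ht0 : 0 ≤ t₀) (ht1 : t₀ ≤ 1)
    (hZ₁pos : 0 < (1 - 1 * μ) ^ K - 1 * mc) (hZ₀pos : 0 < (1 - t₀ * μ) ^ K - t₀ * mc) :
    (1 - t₀) * (1 + K * μ) * (xc * Real.exp (-(xc + s) + t₀ * (K * μ))) ≤
      (Real.log ((1 - t₀ * μ) ^ K - t₀ * mc) - Real.log ((1 - t₀ * μ) ^ K)) -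
        (Real.log ((1 - 1 * μ) ^ K - 1 * mc) - Real.log ((1 - 1 * μ) ^ K)) := by
  have hmc0 : 0 ≤ mc := by rw [hmc]; positivity
  have h1μ : 0 < 1 - μ := by linarith
  have h1t : 0 < 1 - t₀ * μ := by nlinarith [mul_le_mul ht1 hμ1.le hμ0 zero_le_one]
  -- names for the closed forms
  set q₁ : ℝ := (1 - 1 * μ) ^ K with hq₁
  set q₀ : ℝ := (1 - t₀ * μ) ^ K with hq₀
  set Z₁ : ℝ := (1 - 1 * μ) ^ K - 1 * mc with hZ₁
  set Z₀ : ℝ := (1 - t₀ * μ) ^ K - t₀ * mc with hZ₀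
  have hq₁pos : 0 < q₁ := by rw [hq₁, one_mul]; exact pow_pos h1μ K
  have hq₀pos : 0 < q₀ := by rw [hq₀]; exact pow_pos h1t K
  rw [← Real.log_div hZ₀pos.ne' hq₀pos.ne', ← Real.log_div hZ₁pos.ne' hq₁pos.ne',
    ← Real.log_div (div_pos hZ₀pos hq₀pos).ne' (div_pos hZ₁pos hq₁pos).ne']
  have hρ₀ : Z₀ / q₀ = 1 - t₀ * mc / q₀ := by
    rw [hZ₀, hq₀, sub_div, div_self hq₀pos.ne']
  have hρ₁ : Z₁ / q₁ = 1 - mc / q₁ := by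
    rw [hZ₁, hq₁, sub_div, div_self hq₁pos.ne', one_mul]
  -- Bernoulli: q₀ ≥ q₁ · (1 + K (1 - t₀) μ)
  have hεμ : 0 ≤ (1 - t₀) * μ := mul_nonneg (sub_nonneg.2 ht1) hμ0
  have hbase : (1 - μ) * (1 + (1 - t₀) * μ) ≤ 1 - t₀ * μ := by nlinarith [mul_nonneg hμ0 hμ0]
  have hbern : q₁ * (1 + K * ((1 - t₀) * μ)) ≤ q₀ := by
    have h1 : (1 : ℝ) + K * ((1 - t₀) * μ) ≤ (1 + (1 - t₀) * μ) ^ K := one_add_mul_le_pow (by linarith) K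
    calc q₁ * (1 + K * ((1 - t₀) * μ)) ≤ (1 - μ) ^ K * (1 + (1 - t₀) * μ) ^ K := by
          rw [hq₁, one_mul]; exact mul_le_mul_of_nonneg_left h1 (pow_nonneg h1μ.le K)
      _ = ((1 - μ) * (1 + (1 - t₀) * μ)) ^ K := (mul_pow _ _ _).symm
      _ ≤ (1 - t₀ * μ) ^ K := pow_le_pow_left₀ (mul_nonneg h1μ.le (by linarith)) hbase K
      _ = q₀ := hq₀.symm
  -- the difference of the ratios
  have hdiff : (1 - t₀) * (1 + K * μ) * (mc / q₀) ≤ mc / q₁ - t₀ * mc / q₀ := by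
    have h1 : (1 + K * ((1 - t₀) * μ)) / q₀ ≤ 1 / q₁ := by
      rw [div_le_div_iff₀ hq₀pos hq₁pos, one_mul, mul_comm]; exact hbern
    have h2 : mc / q₁ - t₀ * mc / q₀ = mc * (1 / q₁ - t₀ / q₀) := by ring
    have h3 : (1 - t₀) * (1 + K * μ) * (mc / q₀) = mc * ((1 + K * ((1 - t₀) * μ)) / q₀ - t₀ / q₀) := by ring
    rw [h2, h3]
    exact mul_le_mul_of_nonneg_left (by linarith) hmc0
  -- `1 / q₀ ≥ e^{t₀ K μ}`
  have hq₀exp : Real.exp (t₀ * (K * μ)) ≤ 1 / q₀ := by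
    rw [le_div_iff₀ hq₀pos]
    have h1 : 1 - t₀ * μ ≤ Real.exp (-(t₀ * μ)) := by linarith [Real.add_one_le_exp (-(t₀ * μ))]
    have h2 : q₀ ≤ Real.exp (-(t₀ * μ)) ^ K := by rw [hq₀]; exact pow_le_pow_left₀ h1t.le h1 K
    calc Real.exp (t₀ * (K * μ)) * q₀ ≤ Real.exp (t₀ * (K * μ)) * Real.exp (-(t₀ * μ)) ^ K :=
          mul_le_mul_of_nonneg_left h2 (Real.exp_nonneg _)
      _ = 1 := by rw [← Real.exp_nat_mul, ← Real.exp_add]; ring_nf; exact Real.exp_zero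
  have hlow : (1 - t₀) * (1 + K * μ) * (xc * Real.exp (-(xc + s) + t₀ * (K * μ))) ≤
      (1 - t₀) * (1 + K * μ) * (mc / q₀) := by
    refine mul_le_mul_of_nonneg_left ?_ (mul_nonneg (sub_nonneg.2 ht1) (by positivity))
    rw [Real.exp_add, ← mul_assoc, ← hmc]
    calc mc * Real.exp (t₀ * (K * μ)) ≤ mc * (1 / q₀) := mul_le_mul_of_nonneg_left hq₀exp hmc0
      _ = mc / q₀ := by rw [mul_one_div]
  -- `0 < Z₀/q₀ ≤ 1`, and `log x ≥ 1 - 1/x`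
  have hρ₀pos : 0 < Z₀ / q₀ := div_pos hZ₀pos hq₀pos
  have hρ₁pos : 0 < Z₁ / q₁ := div_pos hZ₁pos hq₁pos
  have hρ₀le : Z₀ / q₀ ≤ 1 := by rw [hρ₀]; linarith [div_nonneg (mul_nonneg ht0 hmc0) hq₀pos.le]
  have hpos0 : 0 ≤ (1 - t₀) * (1 + K * μ) * (xc * Real.exp (-(xc + s) + t₀ * (K * μ))) :=
    mul_nonneg (mul_nonneg (sub_nonneg.2 ht1) (by positivity)) (by positivity)
  have hnn : 0 ≤ Z₀ / q₀ - Z₁ / q₁ := by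
    have := hpos0.trans (hlow.trans hdiff)
    rw [hρ₀, hρ₁]; linarith
  calc (1 - t₀) * (1 + K * μ) * (xc * Real.exp (-(xc + s) + t₀ * (K * μ)))
      ≤ mc / q₁ - t₀ * mc / q₀ := hlow.trans hdiff
    _ = Z₀ / q₀ - Z₁ / q₁ := by rw [hρ₀, hρ₁]; ring
    _ ≤ (Z₀ / q₀ - Z₁ / q₁) / (Z₀ / q₀) := by
        rw [le_div_iff₀ hρ₀pos]
        nlinarith
    _ = 1 - ((Z₀ / q₀) / (Z₁ / q₁))⁻¹ := by rw [inv_div, sub_div, div_self hρ₀pos.ne']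
    _ ≤ Real.log ((Z₀ / q₀) / (Z₁ / q₁)) := Real.one_sub_inv_le_log_of_pos (div_pos hρ₀pos hρ₁pos)

/-- The numerics of the scale-`n` parameters `μ = 1∕(8n)`, `xc = 1∕(16n)`, `t₀ = 1 − 1∕(4n)`, `K = 8n²` (`n ≥ 1`). -/
theorem star_scale (n : ℕ) (hn : 1 ≤ n) :
    (0 : ℝ) < n ∧ (1 : ℝ) / (8 * n) ≤ 1 / 8 ∧ (1 : ℝ) / (16 * n) ≤ 1 / 16 ∧
      ((8 * n ^ 2 : ℕ) : ℝ) * (1 / (8 * n)) = n ∧ (n : ℝ) * (1 / (8 * n)) = 1 / 8 ∧ (1 : ℝ) / (4 * n) * n = 1 / 4 ∧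
      (1 : ℝ) / (16 * n) + 1 / (8 * n) * Real.exp (2 * (1 / (8 * n))) ≤ 2 * (1 / (8 * n)) ∧
      (0 : ℝ) ≤ 1 - 1 / (4 * n) ∧ Real.exp (2 * (1 / (8 * n))) ≤ 1 + 2 * (2 * (1 / (8 * (n : ℝ)))) := by
  have hn' : (1 : ℝ) ≤ n := by exact_mod_cast hn
  have hnpos : (0 : ℝ) < n := by linarith
  have hμ : (1 : ℝ) / (8 * n) ≤ 1 / 8 := one_div_le_one_div_of_le (by norm_num) (by linarith)
  have hxc : (1 : ℝ) / (16 * n) ≤ 1 / 16 := one_div_le_one_div_of_le (by norm_num) (by linarith)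
  have hK : ((8 * n ^ 2 : ℕ) : ℝ) * (1 / (8 * n)) = n := by
    rw [mul_one_div, div_eq_iff (by positivity)]; push_cast; ring
  have hnμ : (n : ℝ) * (1 / (8 * n)) = 1 / 8 := by
    rw [mul_one_div, div_eq_iff (by positivity), div_mul_eq_mul_div, eq_div_iff (by norm_num)]; ring
  have h4 : (1 : ℝ) / (4 * n) * n = 1 / 4 := by
    rw [one_div_mul_eq_div, div_eq_iff (by positivity), div_mul_eq_mul_div, eq_div_iff (by norm_num)]; ring
  have hexp : Real.exp (2 * (1 / (8 * n))) ≤ 1 + 2 * (2 * (1 / (8 * (n : ℝ)))) := by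
    -- `e^x ≤ 1 + x + x² ≤ 1 + 2x` on `[0, 1]` (`Real.abs_exp_sub_one_sub_id_le`)
    have hx0 : (0 : ℝ) ≤ 2 * (1 / (8 * n)) := by positivity
    have hx1 : 2 * (1 / (8 * (n : ℝ))) ≤ 1 := by linarith
    have h := Real.abs_exp_sub_one_sub_id_le (x := 2 * (1 / (8 * (n : ℝ)))) (by rw [abs_of_nonneg hx0]; exact hx1)
    nlinarith [(abs_le.1 h).2]
  have hxμ : (1 : ℝ) / (16 * n) = 1 / (8 * n) / 2 := by rw [div_div]; ring_nf
  refine ⟨hnpos, hμ, hxc, hK, hnμ, h4, ?_, ?_, hexp⟩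
  · rw [hxμ]
    nlinarith [Real.exp_nonneg (2 * (1 / (8 * (n : ℝ)))), show (0 : ℝ) ≤ 1 / (8 * n) by positivity]
  · have h14 : (1 : ℝ) / (4 * n) ≤ 1 / 4 := one_div_le_one_div_of_le (by norm_num) (by linarith)
    linarith

end Summit.QuantumFields.BalabanUV.T4Continuum.NE9MajorantRoom
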